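import Literature.Computability.AlgebraicComplexity.StrongUSP
import Mathlib.Data.Nat.Choose.Sum
import Mathlib.Data.Finset.NatAntidiagonal
import Mathlib.Analysis.SpecialFunctions.Pow.Real
import Mathlib.Analysis.SpecificLimits.Normed
import HarnessLib

/-!
# The USP capacity is at most `3/2^{2/3}` (Cohn–Kleinberg–Szegedy–Umans 2005, Lemma 3.2 / 12)

Topic `Literature/Computability/AlgebraicComplexity` (group-theoretic matrix multiplication).
Companion of `StrongUSP.lean`, whose section `USPSize` proves the FINITE content of the proof of
CKSU Lemma 3.2 / 12 (= Anderson–Ji–Xu 2020, Prop. 2: a USP of width `k` has at most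
`uspSizeBound k = Σ_{n₁+n₂+n₃=k} minᵢ binom(k,nᵢ)` rows) and whose module docstring records as NOT
stated there "the strong USP CAPACITY, a `limsup`: the tree has no USP-capacity vocabulary".  This file
proves the lemma itself, AS PRINTED (FOCS 2005 Lemma 3.2 = arXiv:math/0511460 Lemma 12, §3
"Uniquely solvable puzzles", arXiv text p. 5–6):

> "There is a simple upper bound for the USP capacity, which is of course an upper bound for the
> strong USP capacity as well: **Lemma 3.2.** The USP capacity is at most `3/2^{2/3}`."

with the printed proof: "Let `U` be a USP of width `k`. For each triple `n₁,n₂,n₃` of nonnegative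
integers summing to `k`, define the subset `U_{n₁,n₂,n₃}` of `U` to consist of all elements of `U`
containing `n₁` entries that are `1`, `n₂` that are `2`, and `n₃` that are `3`. There are `binom(k+2,2)`
choices of `n₁,n₂,n₃`, so `|U| ≤ binom(k+2,2) · max |U_{n₁,n₂,n₃}|. If two elements of `U` have the
symbol `1` in exactly the same locations, then letting `π₁` interchange them would violate the definition
of a USP, and of course the same holds for `2` or `3`. Thus `|U_{n₁,n₂,n₃}| ≤ minᵢ binom(k,nᵢ) ≤
(3/2^{2/3} + o(1))^k`, where the latter inequality holds because `minᵢ binom(k,nᵢ)` is maximized when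
`n₁ = n₂ = n₃ = k/3`. It follows that `|U| ≤ (3/2^{2/3} + o(1))^k`, as desired."

What is proved here (all sorry-free; no new definitions, no named facts):

* (private `choose_mul_two_pow_le_three_pow`) the one-line estimate that replaces the `o(1)`:
  `binom(k,n) · 2^{k−n} ≤ 3^k` (one term of the binomial expansion of `(1+2)^k`), hence
  (`min_choose_mul_two_pow_le`) `minᵢ binom(k,nᵢ) · 2^{k−⌊k/3⌋} ≤ 3^k` whenever `n₁+n₂+n₃ = k`
  (some `nᵢ ≤ k/3`; this is the printed "maximized when `n₁ = n₂ = n₃ = k/3`" made effective).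
* `card_uspSizeBoundIndex` — "There are `binom(k+2,2)` choices of `n₁,n₂,n₃`" (the index set of
  `uspSizeBound`).
* `uspSizeBound_mul_two_pow_le` — the explicit integer form of the lemma's count:
  `uspSizeBound k · 2^{k−⌊k/3⌋} ≤ binom(k+2,2) · 3^k`, and its real form
  `uspSizeBound_le_choose_mul_pow : uspSizeBound k ≤ binom(k+2,2) · (3/2^{2/3})^k`
  (using `2^{2k/3} ≤ 2^{k−⌊k/3⌋}`), whence for every USP (`IsUSP.card_le_choose_mul_pow`) and every
  strong USP (`IsStrongUSP.card_le_choose_mul_pow`) of width `k` with `s` rows: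
  **`s ≤ binom(k+2,2) · (3/2^{2/3})^k`** — the printed `|U| ≤ (3/2^{2/3} + o(1))^k` with the `o(1)`
  made explicit (`binom(k+2,2)^{1/k} → 1`).
* **Lemma 3.2 / 12 in CKSU's capacity language** (`IsUSP.eventually_card_lt_pow`): CKSU define "the
  strong USP capacity to be the largest constant `C` such that there exist strong USPs of size
  `(C − o(1))^k` and width `k` for infinitely many values of `k` … The USP capacity is defined
  analogously" (arXiv p. 5).  The upper bound `≤ 3/2^{2/3}` says exactly: for every `C > 3/2^{2/3}`
  there is `K` such that every USP of every width `k ≥ K` has fewer than `C^k` rows (so no `C' > 3/2^{2/3}`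
  admits USPs of size `≥ (C' − o(1))^k` for infinitely many `k`).  The same for strong USPs
  (`IsStrongUSP.eventually_card_lt_pow`: "of course an upper bound for the strong USP capacity as
  well"), matching the shape of the tree's lower-bound statement `exists_isStrongUSP_card_ge_pow`
  (`StrongUSPTriangle.lean`: capacity `≥ 2^{2/3}`, CKSU Prop. 18).

Not formalised here: Theorem 3.3 / 13 ("(Coppersmith and Winograd) The USP capacity equals
`3/2^{2/3}`" — the matching LOWER bound, a probabilistic Salem–Spencer-type construction from [CW90]
§6) and Conjecture 3.4 / 14 (strong USP capacity `= 3/2^{2/3}`; an open problem, refuted in its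
`ω = 2` consequence only via the cap-set barrier `Literature/Barriers/MatrixMultiplication/
TricoloredSumFreeBarrier.lean`).  TODO(general form): a `limsup`-valued `uspCapacity` definition; the
statements below are its `∀ C > 3/2^{2/3}, eventually` unfolding.

## References
* H. Cohn, R. Kleinberg, B. Szegedy, C. Umans, *Group-theoretic algorithms for matrix
  multiplication*, FOCS 2005, 379–388; arXiv:math/0511460 (§3, Lemma 3.2 = arXiv Lemma 12, text
  p. 5 L158 – p. 6 L32 of the held copy `paper:arxiv-math_0511460`). [CohnKleinbergSzegedyUmans2005]
* M. Anderson, Z. Ji, A. Y. Xu, *Matrix multiplication: verifying strong uniquely solvable puzzles*,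
  SAT 2020; arXiv:2301.00074v1 (§5 Prop. 2 = the finite count `uspSizeBound`). [AndersonJiXu2020]
-/

namespace Literature.Computability.AlgebraicComplexity

open Finset

/-! ## The binomial estimate replacing the `o(1)` -/

section ChooseBound

/-- One term of the binomial expansion `3^k = (1+2)^k = Σₘ binom(k,m) 2^{k−m}`:
`binom(k,n) · 2^{k−n} ≤ 3^k` (trivially also for `n > k`). [folklore] -/
private theorem choose_mul_two_pow_le_three_pow (k n : ℕ) : k.choose n * 2 ^ (k - n) ≤ 3 ^ k := by
  rcases le_or_gt n k with hn | hn
  · have hmem : n ∈ range (k + 1) := mem_range.2 (Nat.lt_succ_of_le hn)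
    have hle : 1 ^ n * 2 ^ (k - n) * k.choose n ≤
        ∑ m ∈ range (k + 1), 1 ^ m * 2 ^ (k - m) * k.choose m :=
      Finset.single_le_sum (f := fun m => 1 ^ m * 2 ^ (k - m) * k.choose m)
        (fun m _ => Nat.zero_le _) hmem
    calc k.choose n * 2 ^ (k - n) = 1 ^ n * 2 ^ (k - n) * k.choose n := by
          rw [one_pow, one_mul, mul_comm]
      _ ≤ ∑ m ∈ range (k + 1), 1 ^ m * 2 ^ (k - m) * k.choose m := hle
      _ = (1 + 2) ^ k := (add_pow 1 2 k).symm
      _ = 3 ^ k := by norm_num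
  · rw [Nat.choose_eq_zero_of_lt hn, zero_mul]
    exact Nat.zero_le _

/-- "`minᵢ binom(k,nᵢ)` is maximized when `n₁ = n₂ = n₃ = k/3`", effective form: if `n₁+n₂+n₃ = k`
then some `nᵢ ≤ ⌊k/3⌋`, so `minᵢ binom(k,nᵢ) · 2^{k−⌊k/3⌋} ≤ binom(k,nᵢ) · 2^{k−nᵢ} ≤ 3^k`.
[cite: CohnKleinbergSzegedyUmans2005, Lemma 12 (§3, arXiv:math/0511460 p. 6), proof] -/
theorem min_choose_mul_two_pow_le {k n₁ n₂ n₃ : ℕ} (h : n₁ + n₂ + n₃ = k) :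
    min (k.choose n₁) (min (k.choose n₂) (k.choose n₃)) * 2 ^ (k - k / 3) ≤ 3 ^ k := by
  have key : ∀ n, n ≤ k / 3 → min (k.choose n₁) (min (k.choose n₂) (k.choose n₃)) ≤ k.choose n →
      min (k.choose n₁) (min (k.choose n₂) (k.choose n₃)) * 2 ^ (k - k / 3) ≤ 3 ^ k := by
    intro n hn hmin
    calc _ ≤ k.choose n * 2 ^ (k - n) :=
          Nat.mul_le_mul hmin (Nat.pow_le_pow_right (by norm_num) (by omega))
      _ ≤ 3 ^ k := choose_mul_two_pow_le_three_pow k n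
  by_cases h1 : n₁ ≤ k / 3
  · exact key n₁ h1 (min_le_left _ _)
  by_cases h2 : n₂ ≤ k / 3
  · exact key n₂ h2 (le_trans (min_le_right _ _) (min_le_left _ _))
  exact key n₃ (by omega) (le_trans (min_le_right _ _) (min_le_right _ _))

end ChooseBound

/-! ## "There are `binom(k+2,2)` choices of `n₁,n₂,n₃`" -/

section IndexSet

/-- `Σ_{j=0}^{k} (j+1) = binom(k+2,2)` (Pascal's rule). [folklore] -/
private theorem sum_range_succ_eq_choose_two (k : ℕ) :
    ∑ j ∈ range (k + 1), (j + 1) = (k + 2).choose 2 := by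
  induction k with
  | zero => simp
  | succ k ih =>
    rw [Finset.sum_range_succ, ih]
    have e : k + 1 + 2 = k + 2 + 1 := by omega
    rw [e]
    have h := Nat.choose_succ_succ (k + 2) 1
    simp only [Nat.succ_eq_add_one, Nat.reduceAdd, Nat.choose_one_right] at h
    omega

/-- The index set of `uspSizeBound k` — the pairs `(n₁,n₂)` with `n₁+n₂ ≤ k`, i.e. the triples
`n₁+n₂+n₃ = k` — is the disjoint union of the antidiagonals `n₁+n₂ = j`, `j ≤ k`. [folklore] -/
private theorem uspSizeBoundIndex_eq (k : ℕ) :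
    (range (k + 1) ×ˢ range (k + 1)).filter (fun p : ℕ × ℕ => p.1 + p.2 ≤ k) =
      (range (k + 1)).biUnion fun j => antidiagonal j := by
  ext ⟨a, b⟩
  simp only [mem_filter, mem_product, mem_range, mem_biUnion, mem_antidiagonal]
  constructor
  · rintro ⟨-, hab⟩
    exact ⟨a + b, by omega, rfl⟩
  · rintro ⟨j, hj, hab⟩
    omega

/-- "There are `binom(k+2,2)` choices of `n₁,n₂,n₃`" (nonnegative integers summing to `k`): the index
set of `uspSizeBound k` has exactly `binom(k+2,2)` elements.
[cite: CohnKleinbergSzegedyUmans2005, Lemma 12 (§3, arXiv:math/0511460 p. 6), proof] -/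
theorem card_uspSizeBoundIndex (k : ℕ) :
    ((range (k + 1) ×ˢ range (k + 1)).filter (fun p : ℕ × ℕ => p.1 + p.2 ≤ k)).card =
      (k + 2).choose 2 := by
  rw [uspSizeBoundIndex_eq, card_biUnion]
  · simp_rw [Nat.card_antidiagonal]
    exact sum_range_succ_eq_choose_two k
  · intro x _ y _ hxy
    exact Finset.disjoint_left.2 fun p hpx hpy => hxy (by
      simp only [mem_antidiagonal] at hpx hpy
      omega)

end IndexSet

/-! ## Lemma 3.2 / 12: the count, in integers and in reals -/

section Count

/-- **CKSU 2005, Lemma 3.2 / 12, the count (explicit integer form).**  Combining "there are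
`binom(k+2,2)` choices of `n₁,n₂,n₃`" with `|U_{n₁,n₂,n₃}| ≤ minᵢ binom(k,nᵢ)` and the effective
maximisation `minᵢ binom(k,nᵢ) · 2^{k−⌊k/3⌋} ≤ 3^k`:
`uspSizeBound k · 2^{k−⌊k/3⌋} ≤ binom(k+2,2) · 3^k`.
[cite: CohnKleinbergSzegedyUmans2005, Lemma 12 (§3, arXiv:math/0511460 p. 5–6), proof] -/
theorem uspSizeBound_mul_two_pow_le (k : ℕ) :
    uspSizeBound k * 2 ^ (k - k / 3) ≤ (k + 2).choose 2 * 3 ^ k := by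
  rw [uspSizeBound, Finset.sum_mul, ← card_uspSizeBoundIndex k, ← smul_eq_mul, ← Finset.sum_const]
  refine Finset.sum_le_sum fun p hp => ?_
  have hp' : p.1 + p.2 + (k - (p.1 + p.2)) = k := by
    simp only [mem_filter] at hp
    omega
  exact min_choose_mul_two_pow_le hp'

/-- `(2^{2/3})^k ≤ 2^{k−⌊k/3⌋}` (since `⌊k/3⌋ ≤ k/3`). [folklore] -/
private theorem two_rpow_twoThirds_pow_le (k : ℕ) :
    ((2 : ℝ) ^ (2 / 3 : ℝ)) ^ k ≤ (2 : ℝ) ^ (k - k / 3) := by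
  rw [← Real.rpow_mul_natCast (by norm_num : (0 : ℝ) ≤ 2), ← Real.rpow_natCast 2 (k - k / 3)]
  apply Real.rpow_le_rpow_of_exponent_le (by norm_num : (1 : ℝ) ≤ 2)
  have hdiv : ((k / 3 : ℕ) : ℝ) ≤ (k : ℝ) / 3 := Nat.cast_div_le
  rw [Nat.cast_sub (Nat.div_le_self k 3)]
  linarith

/-- **CKSU 2005, Lemma 3.2 / 12, the count (real form):** `uspSizeBound k ≤ binom(k+2,2) · (3/2^{2/3})^k`
— the printed "`|U| ≤ binom(k+2,2) · maxₙ |Uₙ| ≤ (3/2^{2/3} + o(1))^k`" with the `o(1)` made explicit.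
[cite: CohnKleinbergSzegedyUmans2005, Lemma 12 (§3, arXiv:math/0511460 p. 5–6), proof] -/
theorem uspSizeBound_le_choose_mul_pow (k : ℕ) :
    (uspSizeBound k : ℝ) ≤ ((k + 2).choose 2 : ℝ) * (3 / (2 : ℝ) ^ (2 / 3 : ℝ)) ^ k := by
  have hD : (0 : ℝ) < (2 : ℝ) ^ (k - k / 3) := by positivity
  have hE : (0 : ℝ) < ((2 : ℝ) ^ (2 / 3 : ℝ)) ^ k := by positivity
  have hED := two_rpow_twoThirds_pow_le k
  have h1 : (uspSizeBound k : ℝ) * (2 : ℝ) ^ (k - k / 3) ≤ ((k + 2).choose 2 : ℝ) * 3 ^ k := by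
    exact_mod_cast uspSizeBound_mul_two_pow_le k
  calc (uspSizeBound k : ℝ) ≤ ((k + 2).choose 2 : ℝ) * 3 ^ k / (2 : ℝ) ^ (k - k / 3) := by
        rw [le_div_iff₀ hD]; exact h1
    _ ≤ ((k + 2).choose 2 : ℝ) * 3 ^ k / ((2 : ℝ) ^ (2 / 3 : ℝ)) ^ k :=
        div_le_div_of_nonneg_left (by positivity) hE hED
    _ = ((k + 2).choose 2 : ℝ) * (3 / (2 : ℝ) ^ (2 / 3 : ℝ)) ^ k := by
        rw [div_pow, mul_div_assoc]

variable {s k : ℕ}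

/-- **Cohn–Kleinberg–Szegedy–Umans 2005, Lemma 3.2 / 12 (explicit form for one puzzle).**  Every USP of
width `k` with `s` rows satisfies `s ≤ binom(k+2,2) · (3/2^{2/3})^k` (AS PRINTED: "`|U| ≤
(3/2^{2/3} + o(1))^k`"; here the `o(1)` is the explicit factor `binom(k+2,2)^{1/k}`).
[cite: CohnKleinbergSzegedyUmans2005, Lemma 12 (§3, arXiv:math/0511460 p. 5–6)] -/
theorem IsUSP.card_le_choose_mul_pow {row : Fin s → Fin k → Fin 3} (h : IsUSP row) :
    (s : ℝ) ≤ ((k + 2).choose 2 : ℝ) * (3 / (2 : ℝ) ^ (2 / 3 : ℝ)) ^ k :=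
  le_trans (by exact_mod_cast h.card_le_uspSizeBound) (uspSizeBound_le_choose_mul_pow k)

/-- The same for strong USPs ("of course an upper bound for the strong USP capacity as well").
[cite: CohnKleinbergSzegedyUmans2005, Lemma 12 (§3, arXiv:math/0511460 p. 5), sentence before] -/
theorem IsStrongUSP.card_le_choose_mul_pow {row : Fin s → Fin k → Fin 3} (h : IsStrongUSP row) :
    (s : ℝ) ≤ ((k + 2).choose 2 : ℝ) * (3 / (2 : ℝ) ^ (2 / 3 : ℝ)) ^ k :=
  h.isUSP.card_le_choose_mul_pow

end Count

/-! ## Lemma 3.2 / 12 in the capacity language: "The USP capacity is at most `3/2^{2/3}`" -/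

section Capacity

/-- `binom(k+2,2) ≤ (k+2)^2`. [folklore] -/
private theorem choose_two_le_sq (k : ℕ) : ((k + 2).choose 2 : ℝ) ≤ ((k + 2 : ℕ) : ℝ) ^ 2 := by
  exact_mod_cast Nat.choose_le_pow (k + 2) 2

/-- **Cohn–Kleinberg–Szegedy–Umans 2005, Lemma 3.2 / 12: "The USP capacity is at most `3/2^{2/3}`."**
In CKSU's capacity language ("the largest constant `C` such that there exist [USPs] of size `(C−o(1))^k`
and width `k` for infinitely many values of `k`"): for every `C > 3/2^{2/3}` there is a width `K` beyond
which EVERY USP of width `k` has fewer than `C^k` rows.  Proof: `binom(k+2,2) · (3/2^{2/3})^k < C^k` for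
`k` large, since `(k+2)^2 / (C · 2^{2/3}/3)^{k+2} → 0`.
[cite: CohnKleinbergSzegedyUmans2005, Lemma 12 (§3, arXiv:math/0511460 p. 5–6)] -/
theorem IsUSP.eventually_card_lt_pow {C : ℝ} (hC : 3 / (2 : ℝ) ^ (2 / 3 : ℝ) < C) :
    ∃ K : ℕ, ∀ k ≥ K, ∀ {s : ℕ} {row : Fin s → Fin k → Fin 3}, IsUSP row → (s : ℝ) < C ^ k := by
  set c₀ : ℝ := 3 / (2 : ℝ) ^ (2 / 3 : ℝ) with hc₀
  have hc₀pos : 0 < c₀ := by positivity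
  have hr : 1 < C / c₀ := (one_lt_div hc₀pos).2 hC
  have hrpos : 0 < C / c₀ := lt_trans one_pos hr
  -- `(k+2)^2 / r^(k+2) → 0`, hence eventually `< 1/r^2`
  have ht := (tendsto_pow_const_div_const_pow_of_one_lt 2 hr).comp (Filter.tendsto_add_atTop_nat 2)
  have hev := Filter.Tendsto.eventually_lt_const (show (0 : ℝ) < 1 / (C / c₀) ^ 2 by positivity) ht
  obtain ⟨K, hK⟩ := Filter.eventually_atTop.1 hev
  refine ⟨K, fun k hk s row h => ?_⟩
  have hKk := hK k hk
  simp only [Function.comp] at hKk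
  -- `(k+2)^2 < r^k`
  have h2 : ((k + 2 : ℕ) : ℝ) ^ 2 < (C / c₀) ^ k := by
    rw [div_lt_div_iff₀ (pow_pos hrpos _) (pow_pos hrpos 2), one_mul, pow_add] at hKk
    exact lt_of_mul_lt_mul_right hKk (pow_pos hrpos 2).le
  calc (s : ℝ) ≤ ((k + 2).choose 2 : ℝ) * c₀ ^ k := h.card_le_choose_mul_pow
    _ ≤ ((k + 2 : ℕ) : ℝ) ^ 2 * c₀ ^ k := by gcongr; exact choose_two_le_sq k
    _ < (C / c₀) ^ k * c₀ ^ k := by gcongr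
    _ = C ^ k := by rw [← mul_pow, div_mul_cancel₀ _ hc₀pos.ne']

/-- **"… which is of course an upper bound for the strong USP capacity as well"**: for every
`C > 3/2^{2/3}`, beyond some width every strong USP of width `k` has fewer than `C^k` rows — the
counterpart of `exists_isStrongUSP_card_ge_pow` (capacity `≥ 2^{2/3}`, CKSU Prop. 18).  (CKSU
Conjecture 3.4 / 14 asserts the matching lower bound `3/2^{2/3}` for strong USPs; open.)
[cite: CohnKleinbergSzegedyUmans2005, Lemma 12 (§3, arXiv:math/0511460 p. 5), sentence before] -/
theorem IsStrongUSP.eventually_card_lt_pow {C : ℝ} (hC : 3 / (2 : ℝ) ^ (2 / 3 : ℝ) < C) :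
    ∃ K : ℕ, ∀ k ≥ K, ∀ {s : ℕ} {row : Fin s → Fin k → Fin 3}, IsStrongUSP row → (s : ℝ) < C ^ k := by
  obtain ⟨K, hK⟩ := IsUSP.eventually_card_lt_pow hC
  exact ⟨K, fun k hk s row h => hK k hk h.isUSP⟩

end Capacity

end Literature.Computability.AlgebraicComplexity
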